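import Mathlib
import HarnessLib
import Literature.Computability.Complexity.Space
import Literature.Computability.Complexity.TM2Circuits
import Literature.Computability.Complexity.CircuitClasses
import Literature.Computability.Complexity.PPolyComplement
import Literature.Computability.Complexity.PNPNaturalProofsFixedExponent
import Literature.Computability.Complexity.TimeConstructibleClosure
import Literature.Computability.Complexity.PaulPippengerSzemerediTrotter1983Clocks
import Literature.Computability.MetaComplexity.MCSPStatisticalTest
import Literature.Barriers.PneNP.NaturalProofs
import Literature.Barriers.PneNP.LocalityAsymptotics
import Summits.PneNP.PneNP.Theses.UniformStream
import Summits.PneNP.PneNP.Theorems.UniformStreamUniformStreamLBStubSimulation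
import Summits.PneNP.PneNP.Theorems.UniformStreamUniformStreamLBStubTransfer

/-!
# `HardPRGExist → UniformStreamLB`: the crux of route `UniformStream` follows from the SPRNG conjecture

Crux stmt-PneNP-16045 (`Summit.PneNP.PneNP.Theses.UniformStream.UniformStreamLB`, McKay–Murray–Williams
2019, Thm. 1.3 hypothesis, uniform decision form) and its transferred open core
C⁺ = `stub_MCSP_not_mem_DTISP` (line `birth`/`registered`:
`∃ s` time-constructible `∀ c, MCSPSize s ∉ DTISP(N·s(⌊log₂N⌋)^c, s(⌊log₂N⌋)^c)`) are OPEN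
unconditionally (C⁺ ⇒ crux ⇒ `P ≠ NP` through the route's deciding theorem and item 16047).
This file CALIBRATES them from above, inside the tree's definitions: both follow from the
registered open conjecture `Literature.Barriers.PneNP.HardPRGExist` (a `2^{k^ε}`-hard PRG family in
`P/poly`; Razborov–Rudich's hypothesis, Buss's "SPRNG conjecture"). Chain (Razborov–Rudich 1997,
Thm. 4.1 in the fixed-exponent form of Arora–Barak 2009, Thm. 23.1; Kabanets–Cai 2000, Thm. 4 for the
`MCSP` reading):

1. `exists_cktSize_sim_cfg`, `timeSpaceClass_subset_PPoly` — every language decided by an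
   input-preserving `SpaceMachine` within polynomially many steps has polynomial-size
   `B₂`-circuits (the tableau simulation `TM2Circuits` of Arora–Barak Thm. 6.6, re-read for the
   halting convention of `Space.lean`: any halting configuration, answer on top of the output stack).
2. `isLarge_hardProp` — the property "`circuitSizeOver B2 f > n^k`" is large (Shannon counting,
   `card_filter_circuitSizeOver_le`).
3. `MCSPSize_pow_not_mem_PPoly` — under `HardPRGExist`, `MCSP[n^k] ∉ P/poly` for all large `k`
   (else the property of step 2 would be `P/poly`-natural and useful against `SIZE(n^c)`,
   contradicting the proved fixed-exponent barrier `exists_not_natural_usefulAgainstSize_of_hard_prg`).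
4. `MCSPSize_pow_not_mem_DTISP`, `MCSP_not_mem_DTISP_of_hardPRG` — hence C⁺ with the
   witness `s = n^k` (`DTISP(N·(log N)^{kc}, ·) ⊆ P/poly` by step 1; `n^k` is time constructible).
5. `uniformStreamLB_of_hardPRG` — hence the crux, through the LANDED stubs `stub_transfer`
   (p153228) and `stub_simulation` (p152730) of the line.

So the crux cannot be refuted short of refuting standard cryptography, while (by the landed
assembly) it cannot be proved short of `P ≠ NP`: it is pinned between `HardPRGExist` and `PneNP`.
Lead prover-line-stmt-PneNP-16045-c1-0, 2026-08-17 (supports stmt-PneNP-16045; conditional on the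
`@[conjecture]` `HardPRGExist`, so it closes nothing).
-/

set_option linter.dupNamespace false -- `Summit.PneNP.PneNP.…`: summit = sub-problem (D-0017)

noncomputable section

namespace Summit.PneNP.PneNP.Theorems.UniformStreamLB.HardPRG

open Turing StateTransition Filter Polynomial Finset
open Literature.Computability.Complexity Literature.Computability.MetaComplexity
open Literature.Computability.Complexity.FinTM2Sim

/-! ## 1. Space machines deciding in polynomial time have polynomial-size circuits -/

/-- **Circuit simulation of a `FinTM2` computation halting in an arbitrary configuration**
(variant of `FinTM2.exists_cktSize_sim`, whose halting convention is Mathlib's `haltList`; here the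
machine may halt — label `none` — with arbitrary stack contents, as the space machines of
`Space.lean` do). For every machine `tm`, input translation `g` and designated output symbol `γ₁`
there are `c, D` such that for all `n, T` and capacity `S > n + D·T` some `F` with `B₂`-circuits of
size `≤ c(S+1)(T+1)` tells, whenever the run from the input `x` reaches a halted configuration
`cfg` within `T` steps whose output stack reads `o :: rest`, whether `o = γ₁`.
[cite: AroraBarakCC2009, Thm. 6.6 (proof)] -/
theorem exists_cktSize_sim_cfg (tm : FinTM2) (g : Bool → tm.Γ tm.k₀) (γ₁ : tm.Γ tm.k₁) :
    ∃ c D : ℕ, ∀ n T S : ℕ, n + D * T < S →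
      ∃ F : (Fin n → Bool) → Unit → Bool, CktSize B2 F (c * (S + 1) * (T + 1)) ∧
        ∀ (x : Fin n → Bool) (cfg : tm.Cfg) (o : tm.Γ tm.k₁) (rest : List (tm.Γ tm.k₁)),
          Nonempty (EvalsToInTime tm.step (initList tm (List.ofFn fun i => g (x i))) (some cfg) T) →
          cfg.l = none → cfg.stk tm.k₁ = o :: rest → (F x () = true ↔ o = γ₁) := by
  classical
  refine ⟨simConst tm, TM2Sim.depth tm, fun n T S hS => ⟨_, cktSize_sim (S := S) n T g
    (fun _ cell => decide (cell tm.k₁ = toSym tm tm.k₁ γ₁)), fun x cfg o rest h hl hstk => ?_⟩⟩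
  obtain ⟨h⟩ := h
  have hS0 : 0 < S := by omega
  have hT : (TM2Sim.stepTotal tm)^[T] (initList tm (List.ofFn fun i => g (x i))) = cfg :=
    stepTotal_iterate_eq_of_evals h hl
  have hn : ∀ k, ((initList tm (List.ofFn fun i => g (x i))).stk k).length ≤ n := fun k =>
    (length_initList_le _ k).trans (by simp)
  have hiter : (pStep tm S)^[T] (pInit S n fun i => g (x i)) = absCfg S cfg := by
    rw [← abs_initList, ← abs_iterate_stepTotal _ (TM2Sim.good_initList tm _) hn (by omega) T
      le_rfl, hT]
  have hgood : TM2Sim.Good tm cfg := by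
    have := TM2Sim.Good.iterate tm (TM2Sim.good_initList tm (List.ofFn fun i => g (x i))) T
    rwa [hT] at this
  have ho : TM2Sim.IsSym tm tm.k₁ o := hgood tm.k₁ o (by rw [hstk]; simp)
  rw [sim_apply, hiter, dif_pos hS0]
  simp only [FinTM2Sim.absCfg, absCells, hstk, List.getElem?_cons_zero, Option.bind_some,
    decide_eq_true_eq]
  rw [toSym_of_isSym tm ho]
  constructor
  · intro heq
    by_cases h₁ : TM2Sim.IsSym tm tm.k₁ γ₁
    · rw [toSym_of_isSym tm h₁, Option.some.injEq] at heq
      exact congrArg Subtype.val heq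
    · simp [toSym, h₁] at heq
  · rintro rfl
    rw [toSym_of_isSym tm ho]

/-- **`DTISP(poly, ·) ⊆ P/poly`, exact-class form**: a language decided by an input-preserving space
machine within `t n ≤ p(n)` steps (any space bound) has `B₂`-circuits of polynomial size — the
tableau of Arora–Barak Thm. 6.6 applied to the machine's run, reading the answer off the top of the
output stack of the halting configuration (`DecidesInTimeSpace`/`HaltsWithIn` of `Space.lean`).
[cite: AroraBarakCC2009, Thm. 6.6] -/
theorem timeSpaceClass_subset_PPoly {t s : ℕ → ℕ} (p : Polynomial ℕ) (ht : ∀ n, t n ≤ p.eval n) :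
    TimeSpaceClass t s ⊆ PPoly := by
  intro L hL
  obtain ⟨M, hM⟩ := hL
  obtain ⟨c₀, D, hsim⟩ :=
    exists_cktSize_sim_cfg M.tm (fun b => M.inputAlphabet.symm b) (M.outputAlphabet.symm true)
  set S : ℕ → ℕ := fun n => n + D * p.eval n + 1 with hS
  choose F hF hspec using fun n => hsim n (p.eval n) (S n) (by simp [hS])
  choose C hC using fun n => (hF n).toCircuit
  refine Set.mem_iUnion.2 ⟨Polynomial.C c₀ * (X + Polynomial.C D * p + 2) * (p + 1), C,
    fun n => ⟨(hC n).1, (hC n).2.1.trans (le_of_eq ?_)⟩, fun x => ?_⟩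
  · simp only [hS, eval_mul, eval_add, eval_C, eval_X, eval_ofNat, eval_one]
    ring
  · rw [(hC x.length).2.2]
    obtain ⟨cfg, hcfg⟩ := (hM.2 x).1
    obtain ⟨hev, hstep, hout⟩ := hcfg.mono (ht x.length)
    have hl : cfg.l = none := by
      rcases cfg with ⟨_ | l, v, stk⟩
      · rfl
      · exact absurd hstep (by simp [FinTM2.step, TM2.step])
    have hstk : cfg.stk M.tm.k₁ = [M.outputAlphabet.symm (L.boolIndicator x)] := by
      have := congrArg (List.map M.outputAlphabet.symm) hout
      simpa [List.map_map, Computability.encodeBool] using this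
    have e : M.init x = initList M.tm (List.ofFn fun i => M.inputAlphabet.symm (x.get i)) := by
      change initList M.tm (x.map M.inputAlphabet.symm) = _
      congr 1
      conv_lhs => rw [← List.ofFn_get x]
      rw [List.map_ofFn]
      rfl
    rw [e] at hev
    have key := hspec x.length x.get cfg _ [] hev hl hstk
    rw [Equiv.apply_eq_iff_eq] at key
    rw [Bool.eq_iff_iff, key]

/-! ## 2. The property "circuit complexity above `n^k`" is large -/

/-- Arithmetic core of largeness: for `n ≥ 1`, `k ≥ 1` and `48·n^{2k} ≤ 2ⁿ - 1`, the Shannon count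
`(s+1)(16(n+s+1)²)ˢ(n+s+1)` of functions of circuit size `≤ s = n^k` is at most `2^{2ⁿ-1}`, half of
all functions. [cite: AroraBarakCC2009, Thm. 6.21 (counting circuits)] -/
theorem count_bound {n k : ℕ} (hn : 1 ≤ n) (hk : 1 ≤ k) (hE : 48 * n ^ (2 * k) ≤ 2 ^ n - 1) :
    (n ^ k + 1) * (16 * (n + n ^ k + 1) ^ 2) ^ (n ^ k) * (n + n ^ k + 1) ≤ 2 ^ (2 ^ n - 1) := by
  set s := n ^ k with hs
  set u := n + s + 1 with hu
  have hs1 : 1 ≤ s := Nat.one_le_pow _ _ hn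
  have hns : n ≤ s := by rw [hs]; exact Nat.le_self_pow (by omega) n
  have h16 : 16 * u ^ 2 = (4 * u) ^ 2 := by ring
  have h4u : 4 * u ≤ 2 ^ (4 * u) := Nat.lt_two_pow_self.le
  have hexp : (4 * u) * (2 * s + 2) ≤ 2 ^ n - 1 := by
    have h1 : (4 * u) * (2 * s + 2) ≤ 48 * s ^ 2 := by nlinarith
    have hs2 : s ^ 2 = n ^ (2 * k) := by rw [hs, ← pow_mul, mul_comm]
    rw [hs2] at h1
    exact h1.trans hE
  calc (s + 1) * (16 * u ^ 2) ^ s * u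
      ≤ u * (16 * u ^ 2) ^ s * u := by gcongr; omega
    _ = (4 * u) ^ (2 * s) * (u * u) := by rw [h16, ← pow_mul, mul_comm 2 s]; ring
    _ ≤ (4 * u) ^ (2 * s) * (4 * u) ^ 2 := by gcongr; nlinarith
    _ = (4 * u) ^ (2 * s + 2) := by rw [← pow_add]
    _ ≤ (2 ^ (4 * u)) ^ (2 * s + 2) := Nat.pow_le_pow_left h4u _
    _ = 2 ^ ((4 * u) * (2 * s + 2)) := by rw [← pow_mul]
    _ ≤ 2 ^ (2 ^ n - 1) := Nat.pow_le_pow_right (by norm_num) hexp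

/-- **Largeness**: for `k ≥ 1` the property `Pₙ = {f : {0,1}ⁿ → {0,1} | circuitSizeOver B2 f > n^k}` (the
complement of `MCSP[n^k]` read as a property of Boolean functions) contains at least half of all `n`-variable
functions for all large `n` (so `2^{2ⁿ} ≤ 2ⁿ · |Pₙ|`): at most `(s+1)(16(n+s+1)²)ˢ(n+s+1)` functions
have circuits of size `≤ s = n^k` (`card_filter_circuitSizeOver_le`), which is `≤ 2^{2ⁿ-1}` once
`48 n^{2k} ≤ 2^{n-1}`. [cite: AroraBarakCC2009, Thm. 6.21] [cite: RazborovRudich1997, §2 ("Largeness")] -/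
theorem isLarge_hardProp {k : ℕ} (hk : 1 ≤ k) :
    IsLarge (fun n => {f : (Fin n → Bool) → Bool | n ^ k < circuitSizeOver B2 f}) := by
  classical
  refine ⟨1, ?_⟩
  filter_upwards [eventually_ge_atTop 1,
    Literature.Barriers.PneNP.Locality.eventually_pow_le_two_pow 48 (2 * k)] with n hn hE
  have h2n : 2 ^ n = 2 ^ (n - 1) * 2 := by rw [← pow_succ, Nat.sub_add_cancel hn]
  have hE' : 48 * n ^ (2 * k) ≤ 2 ^ n - 1 := hE.trans (by have := Nat.one_le_two_pow (n := n - 1); omega)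
  have hB := (card_filter_circuitSizeOver_le n (n ^ k)).trans (count_bound hn hk hE')
  have hset : {f : (Fin n → Bool) → Bool | n ^ k < circuitSizeOver B2 f} =
      ↑(Finset.univ.filter fun f : (Fin n → Bool) → Bool => n ^ k < circuitSizeOver B2 f) := by
    ext f; simp
  have hcardP : Nat.card {f : (Fin n → Bool) → Bool | n ^ k < circuitSizeOver B2 f} =
      (Finset.univ.filter fun f : (Fin n → Bool) → Bool => n ^ k < circuitSizeOver B2 f).card := by
    rw [Nat.card_coe_set_eq, hset, Set.ncard_coe_finset]
  have htot := Finset.card_filter_add_card_filter_not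
    (s := (Finset.univ : Finset ((Fin n → Bool) → Bool))) (fun f => circuitSizeOver B2 f ≤ n ^ k)
  have huniv : (Finset.univ : Finset ((Fin n → Bool) → Bool)).card = 2 ^ 2 ^ n := by simp
  have hneg : (Finset.univ.filter fun f : (Fin n → Bool) → Bool => ¬ circuitSizeOver B2 f ≤ n ^ k) =
      Finset.univ.filter fun f => n ^ k < circuitSizeOver B2 f := by
    simp only [not_le]
  rw [hneg, huniv] at htot
  have hX : 2 ^ 2 ^ n = 2 ^ (2 ^ n - 1) * 2 := by rw [← pow_succ, Nat.sub_add_cancel Nat.one_le_two_pow]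
  have h2 : 2 ≤ 2 ^ (1 * n) := by
    rw [one_mul]; exact le_trans (by norm_num) (Nat.pow_le_pow_right (by norm_num) hn)
  rw [hcardP]
  calc 2 ^ 2 ^ n ≤ 2 * (Finset.univ.filter
        fun f : (Fin n → Bool) → Bool => n ^ k < circuitSizeOver B2 f).card := by omega
    _ ≤ 2 ^ (1 * n) * (Finset.univ.filter
        fun f : (Fin n → Bool) → Bool => n ^ k < circuitSizeOver B2 f).card :=
      Nat.mul_le_mul_right _ h2

/-! ## 3. Under `HardPRGExist`, `MCSP[n^k] ∉ P/poly` for all large `k` -/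

/-- **Truth-table languages inherit `P/poly`-membership from any language agreeing with them on
truth tables**: if `L ∈ P/poly` and `tt f ∈ L ↔ f ∈ Pₙ`, then `truthTableLanguage P ∈ P/poly` (use
the circuits of `L` at lengths `2ⁿ` and the constant `0` elsewhere). [folklore] -/
theorem truthTableLanguage_mem_PPoly_of {P : CombinatorialProperty} {L : Language Bool}
    (hL : L ∈ PPoly) (h : ∀ n (f : (Fin n → Bool) → Bool), truthTable f ∈ L ↔ f ∈ P n) :
    truthTableLanguage P ∈ PPoly := by
  classical
  obtain ⟨p, C, hC, hdec⟩ := Set.mem_iUnion.1 hL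
  choose Z hZ using fun N => (cktSize_const (Fin N) false).toCircuit
  refine Set.mem_iUnion.2 ⟨p + 1, fun N => if ∃ n, N = 2 ^ n then C N else Z N, fun N => ?_,
    fun x => ?_⟩
  · dsimp only
    split_ifs
    · exact ⟨(hC N).1, (hC N).2.trans (by simp)⟩
    · exact ⟨(hZ N).1, (hZ N).2.1.trans (by simp)⟩
  · dsimp only
    split_ifs with hx
    · obtain ⟨n, hn⟩ := hx
      rw [hdec x]
      have hiff : x ∈ L ↔ x ∈ truthTableLanguage P := by
        rw [← truthTable_ofTruthTable x hn, h, truthTable_mem_truthTableLanguage_iff]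
      by_cases hxL : x ∈ L
      · rw [(Set.mem_iff_boolIndicator _ _).1 hxL, (Set.mem_iff_boolIndicator _ _).1 (hiff.1 hxL)]
      · rw [(Set.notMem_iff_boolIndicator _ _).1 hxL,
          (Set.notMem_iff_boolIndicator _ _).1 (fun h' => hxL (hiff.2 h'))]
    · rw [(hZ x.length).2.2]
      symm
      refine (Set.notMem_iff_boolIndicator _ _).1 fun hmem => hx ?_
      obtain ⟨n, hlen, -⟩ := (mem_truthTableLanguage_iff P x).1 hmem
      exact ⟨n, hlen⟩

/-- **`HardPRGExist ⇒ MCSP[n^k] ∉ P/poly` for all large `k`** (Razborov–Rudich Thm. 4.1 in the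
fixed-exponent form, Arora–Barak Thm. 23.1, read à la Kabanets–Cai Thm. 4): a polynomial-size circuit
family for `MCSP[n^k]` would make "`circuitSizeOver B2 f > n^k`" a `P/poly`-constructive (complement the circuits),
large (`isLarge_hardProp`) property useful against `SIZE(n^c)` for `k ≥ c`, which the proved barrier
`exists_not_natural_usefulAgainstSize_of_hard_prg` forbids under the hard-PRG hypothesis.
[cite: RazborovRudich1997, Thm. 4.1] [cite: AroraBarakCC2009, Thm. 23.1] [cite: KabanetsCai2000, Thm. 4] -/
theorem MCSPSize_pow_not_mem_PPoly (hG : Literature.Barriers.PneNP.HardPRGExist) :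
    ∃ k₀ : ℕ, 1 ≤ k₀ ∧ ∀ k, k₀ ≤ k → MCSPSize (fun n => n ^ k) ∉ PPoly := by
  obtain ⟨c, hc⟩ := exists_not_natural_usefulAgainstSize_of_hard_prg hG
  refine ⟨max c 1, le_max_right _ _, fun k hk hmem =>
    hc ⟨fun n => {f : (Fin n → Bool) → Bool | n ^ k < circuitSizeOver B2 f},
      ⟨fun n => {f | n ^ k < circuitSizeOver B2 f}, fun _ => subset_rfl, ?_,
        isLarge_hardProp (le_of_max_le_right hk)⟩, ?_⟩⟩
  · exact truthTableLanguage_mem_PPoly_of (compl_mem_PPoly hmem) fun n f => by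
      rw [truthTable_mem_compl_MCSPSize_iff]; rfl
  · filter_upwards [eventually_ge_atTop 1] with n hn f hf
    exact lt_of_le_of_lt (Nat.pow_le_pow_right hn (le_of_max_le_left hk)) hf

/-! ## 4. Hence C⁺ (the registered stub) and the crux, conditionally -/

/-- **`HardPRGExist ⇒ MCSP[n^k] ∉ DTISP(N·(log N)^{kc}, (log N)^{kc})` for every `c`** (large `k`):
the `DTISP` class runs in polynomial time, hence sits inside `P/poly`
(`timeSpaceClass_subset_PPoly`), which `MCSP[n^k]` escapes under the hypothesis.
[cite: KabanetsCai2000, Thm. 4] [cite: AroraBarakCC2009, Thm. 6.6 and Thm. 23.1] -/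
theorem MCSPSize_pow_not_mem_DTISP (hG : Literature.Barriers.PneNP.HardPRGExist) :
    ∃ k : ℕ, 1 ≤ k ∧ ∀ c : ℕ, MCSPSize (fun n => n ^ k) ∉
      DTISP (fun N => N * (Nat.log 2 N ^ k) ^ c) (fun N => (Nat.log 2 N ^ k) ^ c) := by
  obtain ⟨k₀, hk₀, h⟩ := MCSPSize_pow_not_mem_PPoly hG
  refine ⟨k₀, hk₀, fun c hmem => h k₀ le_rfl ?_⟩
  obtain ⟨C, hC⟩ := hmem
  refine timeSpaceClass_subset_PPoly
    (Polynomial.C C * (X * (X ^ k₀) ^ c) + Polynomial.C C) (fun n => ?_) hC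
  simp only [eval_add, eval_mul, eval_C, eval_X, eval_pow]
  gcongr
  exact Nat.log_le_self 2 n

/-- **`HardPRGExist ⇒ C⁺`**: the registered stub `stub_MCSP_not_mem_DTISP` of line `birth` —
`∃ s` time-constructible `∀ c, MCSPSize s ∉ DTISP(N·s(⌊log₂N⌋)^c, s(⌊log₂N⌋)^c)` — holds under the
hard-PRG hypothesis, with witness `s = n^k` (`isTimeConstructible_id.pow`).
[cite: KabanetsCai2000, Thm. 4] [cite: RazborovRudich1997, Thm. 4.1] -/
theorem MCSP_not_mem_DTISP_of_hardPRG (hG : Literature.Barriers.PneNP.HardPRGExist) :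
    ∃ s : ℕ → ℕ, Literature.Computability.Complexity.IsTimeConstructible s ∧ ∀ c : ℕ,
      Literature.Computability.MetaComplexity.MCSPSize s ∉
        Literature.Computability.Complexity.DTISP (fun N => N * s (Nat.log 2 N) ^ c)
          (fun N => s (Nat.log 2 N) ^ c) := by
  obtain ⟨k, hk, h⟩ := MCSPSize_pow_not_mem_DTISP hG
  exact ⟨fun n => n ^ k, isTimeConstructible_id.pow hk, h⟩

/-- **`HardPRGExist ⇒ UniformStreamLB`**: the crux of route `UniformStream` (stmt-PneNP-16045) follows
from the SPRNG conjecture, by the line's landed stubs `stub_transfer` (p153228) and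
`stub_simulation` (p152730) applied to `MCSP_not_mem_DTISP_of_hardPRG`. Conditional on the
registered open conjecture `HardPRGExist`; closes nothing, calibrates the crux from above.
[cite: McKayMurrayWilliams2019, Thm. 1.3 (the hypothesis)] [cite: RazborovRudich1997, Thm. 4.1] [cite: KabanetsCai2000, Thm. 4] -/
theorem uniformStreamLB_of_hardPRG :
    Literature.Barriers.PneNP.HardPRGExist →
      Summit.PneNP.PneNP.Theses.UniformStream.UniformStreamLB :=
  fun hG => Birth.stub_transfer Birth.stub_simulation (MCSP_not_mem_DTISP_of_hardPRG hG)

end Summit.PneNP.PneNP.Theorems.UniformStreamLB.HardPRG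

end
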